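/-
Copyright (c) 2026 the pub-hodgecm-mathlib formalisation cell (harness21).  Prover seat hodgecm-mathlib-K2Liu-p13 (g2), Track B «K2-LIT»,
#184♮ = hLiu418 = `stmt-HodgeConjecture-24832`; D-U1 stage 3 input I2 (LEAD F0P6-plan (g14) BATCH #23 (2); K2E5-plan (g7) «=» 13:54:17Z), file 2 of 2.
-/
import Summits.HodgeConjecture.HodgeConjecture.Theorems.K2LiuKlingenUnipotentCocompact          -- I2 file 1: (C0)_Q + finiteness
import Summits.HodgeConjecture.HodgeConjecture.Theorems.K2LiuUnipotentCoveringWeight           -- ★ generic: `exists_isCoveringWeight_of_cover`, `lintegral_le_measure_of_le_indicator`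
import Summits.HodgeConjecture.HodgeConjecture.Theorems.K2LiuSiegelEisensteinMajorantCompact    -- ★ G1-END: `exists_summable_majorant_on_compact`
import Summits.HodgeConjecture.HodgeConjecture.Theorems.K2LiuSiegelEisensteinSubgroupPeriodCells -- ★ F4-2a: `countable_subgroupOf_ratH`
import HarnessLib

/-!
# Crux `HLiu418`, D-U1 stage 3 input I2, file 2: THE (H)-DISCHARGE FOR THE KLINGEN WEIGHT — a compactly supported `N_Q(L⁺)`-covering weight `β ≤ 1_K` on `N_Q(𝔸)` with
# `0 < ∫ β dνN < ∞` and `∫⁻ (Σ'_x ‖f(γ_x·u·x₀)‖ₑ)·β(u) dνN(u) < ∞` at EVERY base point `x₀ ∈ H(𝔸)`, for `re s > 1 = n∕2` (the `hH` of ★ F4 ∕ ★ F10, the `hβ, hβ0, hβtop` of ★ F5-h ∕ ★ F10)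

Cell `hodgecm-mathlib`, crux item hLiu418 = `stmt-HodgeConjecture-24832`; squad K2 ∕ K2Liu; LEAD F0P6-plan (g14), co-dealer K2E5-plan (g7); prover K2Liu-p13 (g2).
THEOREMS ONLY (no `def`, no instance, no notation, no named-fact hypothesis, no `sorry`); lane `--supports stmt-HodgeConjecture-24832 --as helper` (count-neutral).
The Klingen twin of ★ G1-END `K2LiuSiegelEisensteinMajorantLocallyBounded.exists_weight_lintegral_majorant_ne_top` — but SIMPLER: no Godement height data is needed here, because
★ `K2LiuSiegelEisensteinMajorantCompact.exists_summable_majorant_on_compact` already bounds `Σ'_x ‖f(γ_x · (x₀ · c))‖` by a summable `u` UNIFORMLY for `c` in a compact set; with (C0)_Q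
(I2 file 1) and ★ `exists_isCoveringWeight_of_cover` the weight `β ≤ 1_K` is compactly supported, so `∫⁻ (Σ' …)·β ≤ (Σ u)·νN(K) < ∞`, `∫⁻ β ≤ νN(K) < ∞`, and `∫⁻ β ≠ 0` because a
covering weight of a countable group cannot vanish `νN`-a.e. for a left-invariant `νN ≠ 0`.
* `lintegral_coveringWeight_ne_zero` — generic: `Γ ≤ G` countable, `μ ≠ 0` left-invariant ⇒ `∫⁻ β dμ ≠ 0` for every `Γ`-covering weight `β`;
* **`exists_klingenWeight`** — `∃ β`, `IsCoveringWeight N_Q(L⁺) β ∧ (∃ K compact, β ≤ 1_K) ∧ ∀ νN Haar, ∫⁻ β ≠ 0 ∧ ∫⁻ β ≠ ∞`;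
* **`lintegral_majorant_klingenWeight_ne_top`** — for such `β`, `re s > n∕2`, `f` a continuous Siegel section, `χ` unitary: `∫⁻ u, (Σ'_x ‖f(γ_x (u x₀))‖ₑ) β u ∂νN ≠ ∞` for EVERY `x₀`.
[MoeglinWaldspurger1995, II.1.5–II.1.7], [Garrett2018, §3.10], [Borel1963, §1.2].
HONEST LABEL.  Count-neutral helper: `HC_CM` is proved only modulo the 7 printed citations (2 remaining named inputs: hLiu418 = `stmt-HodgeConjecture-24832`,
h413 = `stmt-HodgeConjecture-24833`) until rung 0 closes.
-/

set_option autoImplicit false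
set_option linter.dupNamespace false -- the mandated namespace repeats `HodgeConjecture.HodgeConjecture`

noncomputable section

open scoped Matrix ENNReal NNReal
open NumberField IsDedekindDomain MeasureTheory MeasureTheory.Measure MulAction

namespace Summit.HodgeConjecture.HodgeConjecture.Cruxes.HLiu418.K2LiuKlingenWeightedMajorant

open Literature.MeasureTheory.Group
open Literature.NumberTheory.Automorphic Literature.NumberTheory.Automorphic.UnitaryGroup
open Literature.NumberTheory.GelbartRogawski1991 Literature.NumberTheory.GelbartRogawski1991.GRConstruction
open Literature.NumberTheory.GaloisRepresentations
open Literature.NumberTheory.K2Lit.SiegelDoubled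
open Summit.HodgeConjecture.HodgeConjecture.Cruxes.HLiu418.K2LiuDoubledUTwoTwoBorelFrame
open Summit.HodgeConjecture.HodgeConjecture.Cruxes.HLiu418.K2LiuKlingenUnipotentAdelicDefs
open Summit.HodgeConjecture.HodgeConjecture.Cruxes.HLiu418.K2LiuKlingenUnipotentCocompact (exists_isCompact_cover_klingenUnipA finite_klingenRat_smul_mem)
open Summit.HodgeConjecture.HodgeConjecture.Cruxes.HLiu418.K2LiuUnipotentCoveringWeight (exists_isCoveringWeight_of_cover lintegral_le_measure_of_le_indicator)
open Summit.HodgeConjecture.HodgeConjecture.Cruxes.HLiu418.K2LiuSiegelEisensteinMajorantCompact (exists_summable_majorant_on_compact)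
open Summit.HodgeConjecture.HodgeConjecture.Cruxes.HLiu418.K2LiuSiegelEisensteinSubgroupPeriodCells (countable_subgroupOf_ratH)
open UnitaryDualPair

/-! ## §1 Generic: a covering weight has nonzero integral -/

section Generic

variable {G : Type*} [Group G] [TopologicalSpace G] [IsTopologicalGroup G] [MeasurableSpace G] [BorelSpace G]

/-- **a covering weight of a countable subgroup has nonzero integral** against any nonzero left-invariant measure: if `∫⁻ β dμ = 0` then `β = 0` a.e., hence
`β(γ ·) = 0` a.e. for each of the countably many `γ` (left invariance), so `Σ_γ β(γ x) = 0` a.e. — but it is `1` everywhere. [folklore] -/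
theorem lintegral_coveringWeight_ne_zero (Γ : Subgroup G) [Countable ↥Γ] (μ : Measure G) [μ.IsMulLeftInvariant] [NeZero μ]
    {β : G → ℝ≥0∞} (hβ : IsCoveringWeight ↥Γ β) : ∫⁻ x, β x ∂μ ≠ 0 := by
  intro h0
  have hae : ∀ᵐ x ∂μ, β x = 0 := (lintegral_eq_zero_iff hβ.1).1 h0
  have hγ : ∀ γ : ↥Γ, ∀ᵐ x ∂μ, β ((γ : G) * x) = 0 := fun γ => by
    have h := hae
    rw [← map_mul_left_eq_self μ (γ : G)] at h
    exact ae_of_ae_map (measurable_const_mul (γ : G)).aemeasurable h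
  have hall : ∀ᵐ x ∂μ, ∀ γ : ↥Γ, β ((γ : G) * x) = 0 := ae_all_iff.2 hγ
  obtain ⟨x, hx⟩ := hall.exists
  have h1 := hβ.2 x
  simp only [coveringSum, Subgroup.smul_def, smul_eq_mul, hx, tsum_zero] at h1
  exact zero_ne_one h1

end Generic

variable {L : Type} [Field L] [NumberField L] [IsCMField L]
variable {N M : ℕ} {e : Fin N × Fin M ≃ Fin 2}
  {dV : Fin N → L} {hdV : ∀ i, IsCMField.complexConj L (dV i) = dV i}
  {dW : Fin M → L} {hdW : ∀ i, IsCMField.complexConj L (dW i) = dW i}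

section Transport

variable {SA : GL (Fin (2 + 2)) (AdeleRing (𝓞 L) L)}
  {Ψ : (quasiSplit (Fp L) L (IsCMField.complexConj L) (2 + 2)).Adelic ≃ₜ* HA L e dV hdV dW hdW} {X Y : Matrix (Fin 2) (Fin 2) (Fp L)} {a : Fp L}
  (hΨ : ∀ g : (quasiSplit (Fp L) L (IsCMField.complexConj L) (2 + 2)).Adelic,
    (((Ψ g : HA L e dV hdV dW hdW) : GL (Fin (2 + 2)) (AdeleRing (𝓞 L) L)) : Matrix (Fin (2 + 2)) (Fin (2 + 2)) (AdeleRing (𝓞 L) L)) =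
      (SA : Matrix (Fin (2 + 2)) (Fin (2 + 2)) (AdeleRing (𝓞 L) L)) *
        ((adelicVal (Fp L) L (IsCMField.complexConj L) (2 + 2) _ g : GL (Fin (2 + 2)) (AdeleRing (𝓞 L) L)) :
          Matrix (Fin (2 + 2)) (Fin (2 + 2)) (AdeleRing (𝓞 L) L)) *
        ((SA⁻¹ : GL (Fin (2 + 2)) (AdeleRing (𝓞 L) L)) : Matrix (Fin (2 + 2)) (Fin (2 + 2)) (AdeleRing (𝓞 L) L)))
  (ha : a + a = 1)
  (hSA : Matrix.reindex (e₂ (n := 2)).symm (e₂ (n := 2)).symm (SA : Matrix (Fin (2 + 2)) (Fin (2 + 2)) (AdeleRing (𝓞 L) L)) =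
    Matrix.fromBlocks (1 : Matrix (Fin 2) (Fin 2) (AdeleRing (𝓞 L) L)) (X.map ((algebraMap L (AdeleRing (𝓞 L) L)).comp (algebraMap (Fp L) L))) 1
      (-(X.map ((algebraMap L (AdeleRing (𝓞 L) L)).comp (algebraMap (Fp L) L)))))
  (hSAi : Matrix.reindex (e₂ (n := 2)).symm (e₂ (n := 2)).symm ((SA⁻¹ : GL (Fin (2 + 2)) (AdeleRing (𝓞 L) L)) : Matrix (Fin (2 + 2)) (Fin (2 + 2)) (AdeleRing (𝓞 L) L)) =
    Matrix.fromBlocks ((a • (1 : Matrix (Fin 2) (Fin 2) (Fp L))).map ((algebraMap L (AdeleRing (𝓞 L) L)).comp (algebraMap (Fp L) L)))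
      ((a • (1 : Matrix (Fin 2) (Fin 2) (Fp L))).map ((algebraMap L (AdeleRing (𝓞 L) L)).comp (algebraMap (Fp L) L)))
      (Y.map ((algebraMap L (AdeleRing (𝓞 L) L)).comp (algebraMap (Fp L) L)))
      (-(Y.map ((algebraMap L (AdeleRing (𝓞 L) L)).comp (algebraMap (Fp L) L)))))
  (hXY : X * Y = a • (1 : Matrix (Fin 2) (Fin 2) (Fp L))) (hYX : Y * X = a • (1 : Matrix (Fin 2) (Fin 2) (Fp L)))

/-! ## §2 The Klingen weight -/

include hΨ ha hSA hSAi hXY hYX in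
/-- **A COMPACTLY SUPPORTED `N_Q(L⁺)`-COVERING WEIGHT ON `N_Q(𝔸)` WITH FINITE NONZERO MASS** (★ `exists_isCoveringWeight_of_cover` on (C0)_Q of I2 file 1).
[cite: MoeglinWaldspurger1995, II.1.6] [cite: Borel1963, §1.2] -/
theorem exists_klingenWeight [MeasurableSpace ↥(klingenUnipA Ψ)] [BorelSpace ↥(klingenUnipA Ψ)] :
    ∃ β : ↥(klingenUnipA Ψ) → ℝ≥0∞, IsCoveringWeight ↥((ratH L e dV hdV dW hdW).subgroupOf (klingenUnipA Ψ)) β ∧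
      (∃ K : Set ↥(klingenUnipA Ψ), IsCompact K ∧ ∀ u, β u ≤ K.indicator 1 u) ∧
      ∀ (νN : Measure ↥(klingenUnipA Ψ)) [νN.IsMulLeftInvariant] [IsFiniteMeasureOnCompacts νN] [NeZero νN],
        ∫⁻ u, β u ∂νN ≠ 0 ∧ ∫⁻ u, β u ∂νN ≠ ∞ := by
  haveI : Countable ↥((ratH L e dV hdV dW hdW).subgroupOf (klingenUnipA Ψ)) := countable_subgroupOf_ratH _
  obtain ⟨K, hK, hcover⟩ := exists_isCompact_cover_klingenUnipA hΨ ha hSA hSAi hXY hYX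
  obtain ⟨β, hβ, -, hβK⟩ := exists_isCoveringWeight_of_cover hK.isClosed.measurableSet (finite_klingenRat_smul_mem hK) hcover
  refine ⟨β, hβ, ⟨K, hK, hβK⟩, fun νN _ _ _ => ⟨lintegral_coveringWeight_ne_zero _ νN hβ, ?_⟩⟩
  exact ((lintegral_le_measure_of_le_indicator νN hK.isClosed.measurableSet hβK).trans_lt hK.measure_lt_top).ne

/-! ## §3 (H) at every base point -/

/-- **THE (H)-DISCHARGE FOR THE KLINGEN WEIGHT**: for `re s > n∕2`, a continuous Siegel section `f` of `I_Δ(s,χ)` (`χ` unitary), a weight `β ≤ 1_K` with `K ⊆ N_Q(𝔸)` compact, and a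
measure `νN` finite on compacts (no measurability of `β` needed): `∫⁻ u, (Σ'_x ‖f(γ_x · (u · x₀))‖ₑ)·β(u) dνN(u) < ∞` for EVERY `x₀ ∈ H(𝔸)` — ★ `exists_summable_majorant_on_compact` on the compact `K · x₀`.
[cite: MoeglinWaldspurger1995, II.1.5] [cite: Garrett2018, §3.10] -/
theorem lintegral_majorant_klingenWeight_ne_top (hdV0 : ∀ i, dV i ≠ 0) (hdW0 : ∀ i, dW i ≠ 0)
    [MeasurableSpace ↥(klingenUnipA Ψ)] [BorelSpace ↥(klingenUnipA Ψ)] (νN : Measure ↥(klingenUnipA Ψ)) [IsFiniteMeasureOnCompacts νN]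
    {χ : HeckeCharacter L} (hχ : χ.IsUnitary) {s : ℂ} (hs : (2 : ℝ) / 2 < s.re)
    {f : HA L e dV hdV dW hdW → ℂ} (hf : IsSiegelDeltaSection L e dV hdV dW hdW χ s f) (hfc : Continuous f)
    {β : ↥(klingenUnipA Ψ) → ℝ≥0∞} {K : Set ↥(klingenUnipA Ψ)} (hK : IsCompact K) (hβK : ∀ u, β u ≤ K.indicator 1 u)
    (x₀ : HA L e dV hdV dW hdW) :
    ∫⁻ u, (∑' x : SiegelDeltaQuot L e dV hdV dW hdW,
        ‖f ((((Quotient.out x : ratH L e dV hdV dW hdW) : HA L e dV hdV dW hdW)) * ((u : HA L e dV hdV dW hdW) * x₀))‖ₑ) * β u ∂νN ≠ ∞ := by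
  -- the compact `K · x₀ ⊆ H(𝔸)` and the uniform summable majorant on it
  have hC : IsCompact ((fun u : ↥(klingenUnipA Ψ) => (u : HA L e dV hdV dW hdW) * x₀) '' K) := hK.image (continuous_subtype_val.mul continuous_const)
  obtain ⟨w, hw, hle⟩ := exists_summable_majorant_on_compact L e dV hdV hdV0 dW hdW hdW0 hχ hs hf hfc 1 hC
  have hle' : ∀ u : ↥(klingenUnipA Ψ), u ∈ K → ∀ q : SiegelDeltaQuot L e dV hdV dW hdW,
      ‖f ((((Quotient.out q : ratH L e dV hdV dW hdW) : HA L e dV hdV dW hdW)) * ((u : HA L e dV hdV dW hdW) * x₀))‖ ≤ w q := fun u hu q => by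
    simpa only [one_mul] using hle ((u : HA L e dV hdV dW hdW) * x₀) ⟨u, hu, rfl⟩ q
  by_cases hKne : K.Nonempty
  · obtain ⟨k, hk⟩ := hKne
    have hw0 : ∀ q, 0 ≤ w q := fun q => (norm_nonneg _).trans (hle' k hk q)
    have hS : ∀ u : ↥(klingenUnipA Ψ), u ∈ K → (∑' x : SiegelDeltaQuot L e dV hdV dW hdW,
        ‖f ((((Quotient.out x : ratH L e dV hdV dW hdW) : HA L e dV hdV dW hdW)) * ((u : HA L e dV hdV dW hdW) * x₀))‖ₑ) ≤ ENNReal.ofReal (∑' q, w q) := fun u hu => by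
      rw [ENNReal.ofReal_tsum_of_nonneg hw0 hw]
      exact ENNReal.tsum_le_tsum fun q => by
        rw [← ofReal_norm]
        exact ENNReal.ofReal_le_ofReal (hle' u hu q)
    have hbound : ∀ u : ↥(klingenUnipA Ψ), (∑' x : SiegelDeltaQuot L e dV hdV dW hdW,
        ‖f ((((Quotient.out x : ratH L e dV hdV dW hdW) : HA L e dV hdV dW hdW)) * ((u : HA L e dV hdV dW hdW) * x₀))‖ₑ) * β u ≤ ENNReal.ofReal (∑' q, w q) * K.indicator 1 u := fun u => by
      by_cases hu : u ∈ K
      · have h1 : K.indicator (1 : ↥(klingenUnipA Ψ) → ℝ≥0∞) u = 1 := by rw [Set.indicator_of_mem hu, Pi.one_apply]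
        rw [h1]
        exact mul_le_mul' (hS u hu) ((hβK u).trans_eq h1)
      · have h0 : β u = 0 := le_antisymm ((hβK u).trans_eq (by rw [Set.indicator_of_notMem hu])) bot_le
        rw [h0, mul_zero]
        exact bot_le
    refine ((lintegral_mono hbound).trans_lt ?_).ne
    rw [lintegral_const_mul _ (measurable_one.indicator hK.isClosed.measurableSet), lintegral_indicator_one hK.isClosed.measurableSet]
    exact ENNReal.mul_lt_top ENNReal.ofReal_lt_top hK.measure_lt_top
  · have h0 : ∀ u : ↥(klingenUnipA Ψ), β u = 0 := fun u =>
      le_antisymm ((hβK u).trans_eq (by rw [Set.not_nonempty_iff_eq_empty.1 hKne, Set.indicator_empty])) bot_le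
    simp only [h0, mul_zero, lintegral_zero]
    exact ENNReal.zero_ne_top

end Transport

end Summit.HodgeConjecture.HodgeConjecture.Cruxes.HLiu418.K2LiuKlingenWeightedMajorant

end
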